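import Summits.AtomisticToContinuum.BoseEinsteinCondensation.Theses.BECStronglyRayleigh
import Literature.MathematicalPhysics.QuantumLattice.LiebMattisSectorPF
import Literature.MathematicalPhysics.QuantumLattice.ApproximateEigenvectorLemmas
import HarnessLib

/-!
# Stub `stub_ladderStep` (line `Sketch`, crux `KineticLatticeBEC`, stmt-AtomisticToContinuum-9671)

The exact one-rung algebra of the sector ladder for spin `½` on a finite set `Λ`, with
`Ŝ± = Ŝˣ_tot ± iŜʸ_tot = totalSpin 1 0 ± I • totalSpin 1 1 : Op Λ 2`:

* (i) `|⟨ψ₁, Ŝ⁺ψ₀⟩|² ≤ ‖ψ₀‖² · ‖Ŝ⁻ψ₁‖²`: move `Ŝ⁺` across the pairing using `(Ŝ⁻)ᴴ = Ŝ⁺`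
  (`LiebMattis.conjTranspose_totalSpin_lower`), so `ψ₁⋆ · (Ŝ⁺ψ₀) = (Ŝ⁻ψ₁)⋆ · ψ₀`, then Cauchy–Schwarz
  (`norm_star_dotProduct_le`, `eucNorm_sq`);
* (ii) `‖Ŝ⁺ψ₀‖² = ‖Ŝ⁻ψ₀‖² − 2M‖ψ₀‖²` for `ψ₀` in the sector `Ŝᶻ_tot = M`: the tree identity
  `LiebMattis.re_norm_lower_eq` (`[Ŝ⁺, Ŝ⁻] = 2Ŝᶻ`) rearranged.
-/

noncomputable section

namespace Summit.AtomisticToContinuum.BoseEinsteinCondensation.Cruxes.KineticLatticeBEC.SectorLadder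

open scoped BigOperators Matrix ComplexOrder
open Literature.MathematicalPhysics.QuantumLattice Matrix Complex

/-- **Adjoint of the raising operator inside the pairing**: `ψ₁⋆ · (Ŝ⁺ψ₀) = (Ŝ⁻ψ₁)⋆ · ψ₀`
(spin `½`, from `(Ŝ⁻_tot)ᴴ = Ŝ⁺_tot`). [folklore] -/
theorem star_dotProduct_raise_mulVec (Λ : Type) [Fintype Λ] [DecidableEq Λ]
    (ψ₀ ψ₁ : TensorIndex Λ 2 → ℂ) :
    star ψ₁ ⬝ᵥ ((totalSpin 1 0 + I • totalSpin 1 1 : Op Λ 2) *ᵥ ψ₀) =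
      star ((totalSpin 1 0 - I • totalSpin 1 1 : Op Λ 2) *ᵥ ψ₁) ⬝ᵥ ψ₀ := by
  rw [dotProduct_mulVec, star_mulVec, LiebMattis.conjTranspose_totalSpin_lower]

/-- **Cauchy–Schwarz, squared form**: `|u⋆ · v|² ≤ Re(u⋆ · u) · Re(v⋆ · v)`. [folklore] -/
theorem norm_star_dotProduct_sq_le {n : Type} [Fintype n] (u v : n → ℂ) :
    ‖star u ⬝ᵥ v‖ ^ 2 ≤ (star u ⬝ᵥ u).re * (star v ⬝ᵥ v).re := by
  have hcs := norm_star_dotProduct_le u v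
  have h2 : ‖star u ⬝ᵥ v‖ ^ 2 ≤ (eucNorm u * eucNorm v) ^ 2 :=
    pow_le_pow_left₀ (norm_nonneg _) hcs 2
  rwa [mul_pow, eucNorm_sq, eucNorm_sq] at h2

/-- **Stub B — ladder step.** For `ψ₀` in the sector `Ŝᶻ_tot = M` (spin `½`, any finite `Λ`) and any
`ψ₁`: (i) `|⟨ψ₁, Ŝ⁺ψ₀⟩|² ≤ ‖ψ₀‖² · ‖Ŝ⁻ψ₁‖²` (Cauchy–Schwarz after `(Ŝ⁺)ᴴ = Ŝ⁻`), and
(ii) `‖Ŝ⁺ψ₀‖² = ‖Ŝ⁻ψ₀‖² − 2M‖ψ₀‖²` (`[Ŝ⁺, Ŝ⁻] = 2Ŝᶻ`). [folklore] -/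
theorem stub_ladderStep (Λ : Type) [Fintype Λ] [DecidableEq Λ] (M : ℝ)
    (ψ₀ ψ₁ : TensorIndex Λ 2 → ℂ) (h₀ : ψ₀ ∈ spinZSector 1 M) :
    ‖star ψ₁ ⬝ᵥ ((totalSpin 1 0 + I • totalSpin 1 1 : Op Λ 2) *ᵥ ψ₀)‖ ^ 2 ≤
        (star ψ₀ ⬝ᵥ ψ₀).re *
          (star ((totalSpin 1 0 - I • totalSpin 1 1 : Op Λ 2) *ᵥ ψ₁) ⬝ᵥ
            ((totalSpin 1 0 - I • totalSpin 1 1 : Op Λ 2) *ᵥ ψ₁)).re ∧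
      (star ((totalSpin 1 0 + I • totalSpin 1 1 : Op Λ 2) *ᵥ ψ₀) ⬝ᵥ
          ((totalSpin 1 0 + I • totalSpin 1 1 : Op Λ 2) *ᵥ ψ₀)).re =
        (star ((totalSpin 1 0 - I • totalSpin 1 1 : Op Λ 2) *ᵥ ψ₀) ⬝ᵥ
            ((totalSpin 1 0 - I • totalSpin 1 1 : Op Λ 2) *ᵥ ψ₀)).re - 2 * M * (star ψ₀ ⬝ᵥ ψ₀).re := by
  refine ⟨?_, ?_⟩
  · -- (i): adjoint, then Cauchy–Schwarz with `u := Ŝ⁻ψ₁`, `v := ψ₀`, then commute the product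
    rw [star_dotProduct_raise_mulVec, mul_comm]
    exact norm_star_dotProduct_sq_le _ _
  · -- (ii): `‖Ŝ⁻ψ₀‖² = ‖Ŝ⁺ψ₀‖² + 2M‖ψ₀‖²` rearranged
    have h := LiebMattis.re_norm_lower_eq 1 h₀
    linarith

end Summit.AtomisticToContinuum.BoseEinsteinCondensation.Cruxes.KineticLatticeBEC.SectorLadder
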